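import Summits.QuantumFields.YangMills.Theses.ConvexGribovBody
import Literature.MathematicalPhysics.QuantumFieldTheory.LatticeGaugeProofs
import Literature.MathematicalPhysics.QuantumFieldTheory.WilsonWeakCouplingBounds
import Literature.MathematicalPhysics.QuantumFieldTheory.LatticeGaugeDobrushinPoincare
import Literature.MathematicalPhysics.QuantumLattice.TorusWilsonFlowExistence
import Literature.MathematicalPhysics.QuantumLattice.HeatKernelGroupGaugeProofs

/-!
# `ConvexGribovBody.BrascampLiebVacuum` — refuter's toolkit for the Wilson torus measure
(crux stmt-QuantumFields-8779, negative lane)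

General lemmas used by the negative lemmas on the crux
`Summit.QuantumFields.YangMills.Theses.ConvexGribovBody.BrascampLiebVacuum` (all sorry-free):

* `limsup_const_zero` — on `ℝ` the `limsup` of the zero function is `0` along every filter
  (the crux's metric `slope` of a function that ignores a link is therefore `0`, also at `⊥`).
* `isOpenPosMeasure_wilsonMeasure` — for a continuous representation the torus Wilson measure
  charges every non-empty open set (general compact `G`, any `d`, `L`, `β`): the generalisation of
  `QCDPhaseQuenchedReweighting.isOpenPosMeasure_wilsonMeasure_fundamental` (`SU(3)`, fundamental).
* `integral_sq_sub_pos` — under an open-positive finite measure on a compact configuration space a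
  continuous `f` taking two values has `0 < ∫ (f - c)²` for every constant `c` (GENUINE variance:
  the left side of the crux's inequality is never degenerate for continuous non-constant `f`).
* matrix lemmas in the crux's Frobenius conventions: `√fro = ‖·‖_F`, `Re tr u < N` for unitary
  `u ≠ 1`, a four-factor telescoping bound. (Re-used from the tree, imported here for the
  downstream negative files: `QuantumLattice.norm_le_of_mem_unitaryGroup` (`‖u‖_F ≤ N`),
  `QuantumLattice.plaquetteHolonomy_gaugeTransform`, `QuantumFieldTheory.map_inv_eq_conjTranspose`.)
-/

noncomputable section

open scoped BigOperators Topology Matrix Matrix.Norms.Frobenius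
open Filter MeasureTheory
open Literature.MathematicalPhysics.QuantumFieldTheory

namespace Summit.QuantumFields.YangMills.Theorems.BrascampLiebVacuum.Negative

/-! ### General lemmas -/

section General

/-- On `ℝ` the `limsup` of the zero function is `0` along EVERY filter (along `⊥` this is the
junk value `sInf univ = 0`). [folklore] -/
theorem limsup_const_zero {α : Type*} (F : Filter α) :
    Filter.limsup (fun _ : α => (0 : ℝ)) F = 0 := by
  rcases F.eq_or_neBot with rfl | hF
  · rw [Filter.limsup_eq]
    simp only [Filter.eventually_bot, Set.setOf_true]
    exact Real.sInf_of_not_bddBelow not_bddBelow_univ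
  · exact Filter.limsup_const 0

variable {d L N : ℕ} {G : Type*} [Group G] [TopologicalSpace G] [IsTopologicalGroup G]
  [CompactSpace G] [MeasurableSpace G] [BorelSpace G]

/-- **The Wilson measure charges every non-empty open set** (continuous `ρ`, any compact `G`,
any `d`, `L`, `β`): it is the open-positive product Haar measure with density
`Z⁻¹ e^{−β S_W} ≥ Z⁻¹ e^{−|β| B} > 0`, `B` a bound for the Wilson action of the finite torus.
Generalises `isOpenPosMeasure_wilsonMeasure_fundamental` (`QCDPhaseQuenchedReweighting.lean`,
`SU(3)` with its fundamental representation) verbatim. [folklore] -/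
theorem isOpenPosMeasure_wilsonMeasure [NeZero L] (ρ : G →* Matrix (Fin N) (Fin N) ℂ)
    (hρ : Continuous ρ) (β : ℝ) :
    (wilsonMeasure (d := d) (L := L) ρ β).IsOpenPosMeasure := by
  obtain ⟨B, hB⟩ := exists_abs_wilsonAction_le (d := d) (L := L) ρ hρ
  haveI := isProbabilityMeasure_wilsonMeasure (d := d) (L := L) ρ hρ β
  haveI : (haarProbability G).IsOpenPosMeasure := by unfold haarProbability; infer_instance
  have hle : ENNReal.ofReal (Real.exp (-(|β| * B))) •
      (Measure.pi fun _ : Edge d L => haarProbability G) ≤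
      wilsonWeight (d := d) (L := L) ρ β := by
    rw [wilsonWeight, ← withDensity_const]
    refine withDensity_mono (Eventually.of_forall fun U => ENNReal.ofReal_le_ofReal
      (Real.exp_le_exp.2 ?_))
    have h1 : β * wilsonAction ρ U ≤ |β| * B :=
      (le_abs_self _).trans (by rw [abs_mul]; exact mul_le_mul_of_nonneg_left (hB U) (abs_nonneg β))
    linarith
  have hZ : (partitionFunction (d := d) (L := L) ρ β)⁻¹ ≠ 0 := by
    intro h0
    have h1 := measure_univ (μ := wilsonMeasure (d := d) (L := L) ρ β)
    rw [wilsonMeasure, h0, zero_smul] at h1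
    simp at h1
  refine ⟨fun O hO hne => ?_⟩
  rw [wilsonMeasure, Measure.smul_apply, smul_eq_mul]
  refine mul_ne_zero hZ (lt_of_lt_of_le ?_ (Measure.le_iff'.1 hle O)).ne'
  rw [Measure.smul_apply, smul_eq_mul]
  exact ENNReal.mul_pos (ENNReal.ofReal_pos.2 (Real.exp_pos _)).ne' (hO.measure_pos _ hne).ne'

omit [Group G] [IsTopologicalGroup G] [CompactSpace G] [MeasurableSpace G] [BorelSpace G] in
/-- **Genuine variance.** Under an open-positive finite measure on a compact space, a continuous
function taking two different values has `0 < ∫ (f - c)²` for every constant `c`. [folklore] -/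
theorem integral_sq_sub_pos {X : Type*} [TopologicalSpace X] [CompactSpace X] [MeasurableSpace X]
    [OpensMeasurableSpace X] (μ : Measure X) [IsFiniteMeasure μ] [μ.IsOpenPosMeasure]
    {f : X → ℝ} (hf : Continuous f) {U₁ U₂ : X} (hne : f U₁ ≠ f U₂) (c : ℝ) :
    0 < ∫ U, (f U - c) ^ 2 ∂μ := by
  have hg : Continuous fun U => (f U - c) ^ 2 := by fun_prop
  have hint : Integrable (fun U => (f U - c) ^ 2) μ :=
    (BoundedContinuousFunction.mkOfCompact ⟨_, hg⟩).integrable μ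
  rw [integral_pos_iff_support_of_nonneg_ae (Eventually.of_forall fun U => sq_nonneg _) hint]
  refine hg.isOpen_support.measure_pos μ ?_
  by_cases h1 : f U₁ = c
  · refine ⟨U₂, ?_⟩
    rw [Function.mem_support]
    have : f U₂ - c ≠ 0 := fun h => hne (by rw [h1]; linarith)
    positivity
  · refine ⟨U₁, ?_⟩
    rw [Function.mem_support]
    have : f U₁ - c ≠ 0 := fun h => h1 (by linarith)
    positivity

end General

/-! ### Matrix and representation lemmas -/

section MatrixLemmas

variable {N : ℕ}

/-- `√(Σ |M_ab|²)` (the crux's `√fro`) is the Frobenius norm. [folklore] -/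
theorem sqrt_sum_sq_eq_norm (M : Matrix (Fin N) (Fin N) ℂ) :
    Real.sqrt (∑ a, ∑ b, ‖M a b‖ ^ 2) = ‖M‖ := by
  rw [← UnitaryCayley.frobenius_norm_sq, Real.sqrt_sq (norm_nonneg _)]

/-- A unitary matrix other than `1` has `Re tr u < N` (`N - Re tr u = ‖1 - u‖² / 2`). [folklore] -/
theorem re_trace_lt_of_ne_one {u : Matrix (Fin N) (Fin N) ℂ}
    (hu : u ∈ Matrix.unitaryGroup (Fin N) ℂ) (h1 : u ≠ 1) : u.trace.re < N := by
  have h := UnitaryCayley.re_trace_one_sub hu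
  rw [Matrix.trace_sub, Complex.sub_re, Matrix.trace_one, Fintype.card_fin] at h
  have hpos : 0 < ‖(1 : Matrix (Fin N) (Fin N) ℂ) - u‖ :=
    norm_pos_iff.2 (sub_ne_zero.2 (Ne.symm h1))
  simp only [Complex.natCast_re] at h
  nlinarith [hpos]

/-- Four-factor telescoping bound in a normed ring. [folklore] -/
theorem norm_mul₄_sub_mul₄_le {A B C D A' B' C' D' : Matrix (Fin N) (Fin N) ℂ} {K : ℝ}
    (hK : 0 ≤ K) (hB : ‖B‖ ≤ K) (hC : ‖C‖ ≤ K) (hD : ‖D‖ ≤ K) (hA' : ‖A'‖ ≤ K)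
    (hB' : ‖B'‖ ≤ K) (hC' : ‖C'‖ ≤ K) :
    ‖A * B * C * D - A' * B' * C' * D'‖ ≤
      K ^ 3 * (‖A - A'‖ + ‖B - B'‖ + ‖C - C'‖ + ‖D - D'‖) := by
  have e : A * B * C * D - A' * B' * C' * D' =
      (A - A') * B * C * D + A' * (B - B') * C * D + A' * B' * (C - C') * D +
        A' * B' * C' * (D - D') := by noncomm_ring
  have n3 : ∀ X Y Z W : Matrix (Fin N) (Fin N) ℂ, ‖X * Y * Z * W‖ ≤ ‖X‖ * ‖Y‖ * ‖Z‖ * ‖W‖ :=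
    fun X Y Z W =>
    calc ‖X * Y * Z * W‖ ≤ ‖X * Y * Z‖ * ‖W‖ := norm_mul_le _ _
      _ ≤ ‖X * Y‖ * ‖Z‖ * ‖W‖ := by gcongr; exact norm_mul_le _ _
      _ ≤ ‖X‖ * ‖Y‖ * ‖Z‖ * ‖W‖ := by gcongr; exact norm_mul_le _ _
  have t1 : ‖(A - A') * B * C * D‖ ≤ ‖A - A'‖ * K * K * K :=
    (n3 _ _ _ _).trans (by gcongr)
  have t2 : ‖A' * (B - B') * C * D‖ ≤ K * ‖B - B'‖ * K * K :=
    (n3 _ _ _ _).trans (by gcongr)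
  have t3 : ‖A' * B' * (C - C') * D‖ ≤ K * K * ‖C - C'‖ * K :=
    (n3 _ _ _ _).trans (by gcongr)
  have t4 : ‖A' * B' * C' * (D - D')‖ ≤ K * K * K * ‖D - D'‖ :=
    (n3 _ _ _ _).trans (by gcongr)
  rw [e]
  calc _ ≤ ‖(A - A') * B * C * D + A' * (B - B') * C * D + A' * B' * (C - C') * D‖ +
        ‖A' * B' * C' * (D - D')‖ := norm_add_le _ _
    _ ≤ ‖(A - A') * B * C * D + A' * (B - B') * C * D‖ + ‖A' * B' * (C - C') * D‖ +
        ‖A' * B' * C' * (D - D')‖ := by gcongr; exact norm_add_le _ _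
    _ ≤ ‖(A - A') * B * C * D‖ + ‖A' * (B - B') * C * D‖ + ‖A' * B' * (C - C') * D‖ +
        ‖A' * B' * C' * (D - D')‖ := by gcongr; exact norm_add_le _ _
    _ ≤ ‖A - A'‖ * K * K * K + K * ‖B - B'‖ * K * K + K * K * ‖C - C'‖ * K +
        K * K * K * ‖D - D'‖ := by gcongr
    _ = K ^ 3 * (‖A - A'‖ + ‖B - B'‖ + ‖C - C'‖ + ‖D - D'‖) := by ring

end MatrixLemmas

end Summit.QuantumFields.YangMills.Theorems.BrascampLiebVacuum.Negative

end
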